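import Summits.Ventures.PercRepro.PuncturedLYMReroute

/-!
# PercRepro — (SP) BY SUPERPOSITION, PART 3: THE COLUMN SUMS OF THE RE-ROUTING — THE CORRECTED WEIGHTS HAVE EXACT
ROWS AND COLUMNS (p10, gen 31)

* `sum_reroute_col_touched` / `sum_reroute_col_untouched` — the column sum of `reroute D B` is `−errE D B y₀` at
  `insert y₀ B` and `0` at every other `(j+1)`-set (at `#(Y ∩ B) = j − 1` the two near subsets cancel by antisymmetry;
  at `#(Y ∩ B) ≤ j − 2` nothing is near);
* `sum_sups_totalWp`, `sum_subsP_totalWp` — hence `totalW = superW + Σ_B reroute D B` has row sums `1` on `P` and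
  column sums EXACTLY `#P/#Y` at every `(j+1)`-set: a coupling of the uniform measures whenever it is nonnegative.
Nothing here asserts (SP).
-/

namespace PercRepro.PuncturedLYM

open Finset

variable {α : Type} [Fintype α] [DecidableEq α]

/-! ### Column sums of the correction -/

omit [Fintype α] in
/-- The `j`-subsets of a `(j+1)`-set are the `Y.erase z`, `z ∈ Y`. -/
theorem powersetCard_eq_image_erase {j : ℕ} {Y : Finset α} (hY : Y.card = j + 1) :
    Y.powersetCard j = Y.image (fun z => Y.erase z) := by
  ext X
  simp only [mem_powersetCard, mem_image]
  constructor
  · rintro ⟨hXY, hXc⟩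
    have h1 : (Y \ X).card = 1 := by
      rw [card_sdiff_of_subset hXY]
      omega
    obtain ⟨z, hz⟩ := card_eq_one.1 h1
    have hzY : z ∈ Y \ X := hz ▸ mem_singleton_self z
    rw [mem_sdiff] at hzY
    refine ⟨z, hzY.1, ?_⟩
    apply eq_of_subset_of_card_le
    · intro w hw
      rw [mem_erase] at hw
      by_contra hwX
      have : w ∈ Y \ X := mem_sdiff.2 ⟨hw.2, hwX⟩
      rw [hz, mem_singleton] at this
      exact hw.1 this
    · rw [card_erase_of_mem hzY.1, hY, hXc]
      omega
  · rintro ⟨z, hz, rfl⟩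
    exact ⟨erase_subset z Y, by rw [card_erase_of_mem hz, hY]; rfl⟩

/-- A sum over the `P`-subsets of a `(j+1)`-set is a sum over its points, when the summand vanishes on the code
words inside `Y`. -/
theorem sum_subsP_eq_sum_erase {j : ℕ} {D : Finset (Finset α)} {Y : Finset α} (hY : Y.card = j + 1)
    (f : Finset α → ℚ) (hf : ∀ z ∈ Y, Y.erase z ∈ D → f (Y.erase z) = 0) :
    ∑ X ∈ subsP j D Y, f X = ∑ z ∈ Y, f (Y.erase z) := by
  rw [subsP_eq, powersetCard_eq_image_erase hY, filter_image, sum_image]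
  · rw [← sum_filter_add_sum_filter_not Y (fun z => Y.erase z ∉ D)]
    have : ∑ z ∈ Y.filter (fun z => ¬ Y.erase z ∉ D), f (Y.erase z) = 0 := by
      apply sum_eq_zero
      intro z hz
      rw [mem_filter, not_not] at hz
      exact hf z hz.1 hz.2
    rw [this, add_zero]
  · intro z hz z' hz' h
    rw [mem_coe, mem_filter] at hz hz'
    exact erase_injOn Y hz.1 hz'.1 h

omit [Fintype α] in
/-- A near set is never a code word: a code word near `B` would meet `B` in `j − 1` points. -/
theorem not_mem_code_of_near {j : ℕ} {D : Finset (Finset α)} (hD : IsCode j D) {B : Finset α} (hB : B ∈ D)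
    {X : Finset α} (hn : (X ∩ B).card + 1 = j) : X ∉ D := by
  intro hX
  have hne : X ≠ B := by
    intro h
    rw [h, inter_self, hD.1 B hB] at hn
    omega
  have := hD.2 X hX B hB hne
  omega

/-- The near-`B` subsets of `Y = insert y₀ B` are exactly its `P`-subsets, `Y.erase b` for `b ∈ B`. -/
theorem sum_reroute_col_touched {j : ℕ} {D : Finset (Finset α)} (hD : IsCode j D) (hj : 0 < j)
    {B : Finset α} (hB : B ∈ D) {y₀ : α} (hy₀ : y₀ ∉ B) :
    ∑ X ∈ subsP j D (insert y₀ B), reroutep α j D B X (insert y₀ B) = - errE α j D B y₀ := by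
  have hBc := hD.1 B hB
  have hY : (insert y₀ B).card = j + 1 := by rw [card_insert_of_notMem hy₀, hBc]
  -- the point of `Y ∖ (Y.erase z)` is `z`
  have hpt : ∀ z ∈ insert y₀ B, reroutep α j D B ((insert y₀ B).erase z) (insert y₀ B) =
      reroute α j D B ((insert y₀ B).erase z) z := by
    intro z hz
    unfold reroutep
    rw [sdiff_erase_eq_singleton hz, sum_singleton]
  -- the term at `z = y₀` (`X = B ∈ D`) is excluded from `P`; the terms at `z = b ∈ B` are `−errE y₀ / j`
  rw [sum_subsP_eq_sum_erase hY]
  · rw [sum_insert hy₀]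
    have h0 : reroutep α j D B ((insert y₀ B).erase y₀) (insert y₀ B) = 0 := by
      rw [erase_insert hy₀]
      unfold reroutep
      apply sum_eq_zero
      intro y _
      apply reroute_of_not_near
      rw [inter_self, hBc]
      omega
    rw [h0, zero_add]
    have hterm : ∀ b ∈ B, reroutep α j D B ((insert y₀ B).erase b) (insert y₀ B) =
        (1 / (j : ℚ)) * (- errE α j D B y₀) := by
      intro b hb
      rw [hpt b (mem_insert_of_mem hb)]
      have hn : (((insert y₀ B).erase b) ∩ B).card + 1 = j := by
        have : ((insert y₀ B).erase b) ∩ B = B.erase b := by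
          ext w
          simp only [mem_inter, mem_erase, mem_insert]
          constructor
          · rintro ⟨⟨hwb, -⟩, hwB⟩
            exact ⟨hwb, hwB⟩
          · rintro ⟨hwb, hwB⟩
            exact ⟨⟨hwb, Or.inr hwB⟩, hwB⟩
        rw [this, card_erase_of_mem hb, hBc]
        omega
      have hx : ((insert y₀ B).erase b) \ B = {y₀} := by
        ext w
        simp only [mem_sdiff, mem_erase, mem_insert, mem_singleton]
        constructor
        · rintro ⟨⟨-, hw⟩, hwB⟩
          exact hw.resolve_right hwB
        · rintro rfl
          exact ⟨⟨fun h => hy₀ (h ▸ hb), Or.inl rfl⟩, hy₀⟩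
      have hb' : B \ ((insert y₀ B).erase b) = {b} := by
        ext w
        simp only [mem_sdiff, mem_erase, mem_insert, mem_singleton, not_and, not_or]
        constructor
        · rintro ⟨hwB, h⟩
          by_contra hwb
          exact (h hwb).2 hwB
        · rintro rfl
          exact ⟨hb, fun h => absurd rfl h⟩
      rw [reroute_near D hn hx hb' b, if_pos rfl]
    rw [sum_congr rfl hterm, sum_const, hBc, nsmul_eq_mul]
    have hj' : (j : ℚ) ≠ 0 := by exact_mod_cast hj.ne'
    field_simp
  · -- the summand vanishes on code words inside `Y`: they are not near `B`
    intro z hz hzD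
    unfold reroutep
    apply sum_eq_zero
    intro y _
    apply reroute_of_not_near
    intro hn
    exact not_mem_code_of_near hD hB hn hzD

/-- **The column sum of the correction vanishes at every `(j+1)`-set not containing `B`** (`B ∈ D`, `j < n`). -/
theorem sum_reroute_col_untouched {j : ℕ} {D : Finset (Finset α)} (hD : IsCode j D)
    {B : Finset α} (hB : B ∈ D) {Y : Finset α} (hY : Y.card = j + 1) (hBY : ¬ B ⊆ Y) :
    ∑ X ∈ subsP j D Y, reroutep α j D B X Y = 0 := by
  have hBc := hD.1 B hB
  have hpt : ∀ z ∈ Y, reroutep α j D B (Y.erase z) Y = reroute α j D B (Y.erase z) z := by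
    intro z hz
    unfold reroutep
    rw [sdiff_erase_eq_singleton hz, sum_singleton]
  rw [sum_subsP_eq_sum_erase hY]
  · rw [sum_congr rfl hpt]
    -- `m = #(Y ∩ B) ≤ j − 1`; the points of `Y ∩ B` give non-near subsets
    have hm : (Y ∩ B).card < j := by
      by_contra h
      have h' : j ≤ (Y ∩ B).card := not_lt.1 h
      have h2 : Y ∩ B = B := eq_of_subset_of_card_le inter_subset_right (by omega)
      exact hBY (h2 ▸ inter_subset_left)
    have hinB : ∀ z ∈ Y ∩ B, reroute α j D B (Y.erase z) z = 0 := by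
      intro z hz
      apply reroute_of_not_near
      have : (Y.erase z) ∩ B = (Y ∩ B).erase z := by
        ext w
        simp only [mem_inter, mem_erase]
        tauto
      rw [this, card_erase_of_mem hz]
      have := card_pos.2 ⟨z, hz⟩
      omega
    rw [← sum_sdiff (inter_subset_left (s₁ := Y) (s₂ := B)), sum_eq_zero hinB, add_zero]
    rcases Nat.lt_or_ge (Y ∩ B).card (j - 1) with hlt | hge
    · -- `m ≤ j − 2`: nothing is near
      apply sum_eq_zero
      intro z hz
      apply reroute_of_not_near
      have : (Y.erase z) ∩ B ⊆ Y ∩ B := inter_subset_inter (erase_subset z Y) (subset_refl B)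
      have := card_le_card this
      omega
    · -- `m = j − 1`: `Y ∖ B = {y₁, y₂}` and the two near terms cancel
      have hm' : (Y ∩ B).card + 1 = j := by omega
      have h2 : (Y \ (Y ∩ B)).card = 2 := by
        rw [card_sdiff_of_subset inter_subset_left, hY]
        omega
      obtain ⟨y₁, y₂, hne, hY2⟩ := card_eq_two.1 h2
      rw [hY2, sum_pair hne]
      have hy₁ : y₁ ∈ Y \ (Y ∩ B) := hY2 ▸ mem_insert_self _ _
      have hy₂ : y₂ ∈ Y \ (Y ∩ B) := hY2 ▸ mem_insert_of_mem (mem_singleton_self _)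
      simp only [mem_sdiff, mem_inter, not_and] at hy₁ hy₂
      have hy₁B : y₁ ∉ B := hy₁.2 hy₁.1
      have hy₂B : y₂ ∉ B := hy₂.2 hy₂.1
      -- `Y ∖ B = {y₁, y₂}`
      have hYB : Y \ B = {y₁, y₂} := by
        rw [← hY2]
        ext w
        simp only [mem_sdiff, mem_inter, not_and]
        tauto
      obtain ⟨b, hb⟩ : ∃ b, B \ Y = {b} := by
        apply card_eq_one.1
        have := card_sdiff_add_card_inter B Y
        rw [inter_comm] at this
        omega
      have hbY : b ∉ Y := (mem_sdiff.1 (hb ▸ mem_singleton_self b)).2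
      -- the near subset `Y.erase u` (`Y ∖ B = {u, v}`): `X ∖ B = {v}`, `B ∖ X = {b}`
      have near1 : ∀ {u v : α}, u ≠ v → Y \ B = {u, v} → u ∈ Y → v ∈ Y → u ∉ B → v ∉ B →
          ((Y.erase u) ∩ B).card + 1 = j ∧ (Y.erase u) \ B = {v} ∧ B \ (Y.erase u) = {b} := by
        intro u v huv hYB' hu hv huB hvB
        refine ⟨?_, ?_, ?_⟩
        · have : (Y.erase u) ∩ B = Y ∩ B := by
            ext w
            simp only [mem_inter, mem_erase]
            constructor
            · rintro ⟨⟨-, hw⟩, hwB⟩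
              exact ⟨hw, hwB⟩
            · rintro ⟨hw, hwB⟩
              exact ⟨⟨fun h => huB (h ▸ hwB), hw⟩, hwB⟩
          rw [this]
          exact hm'
        · ext w
          simp only [mem_sdiff, mem_erase, mem_singleton]
          constructor
          · rintro ⟨⟨hwu, hwY⟩, hwB⟩
            have : w ∈ Y \ B := mem_sdiff.2 ⟨hwY, hwB⟩
            rw [hYB', mem_insert, mem_singleton] at this
            exact this.resolve_left hwu
          · intro hwv
            rw [hwv]
            exact ⟨⟨fun h => huv h.symm, hv⟩, hvB⟩
        · ext w
          simp only [mem_sdiff, mem_erase, mem_singleton, not_and]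
          constructor
          · rintro ⟨hwB, h⟩
            by_cases hwY : w ∈ Y
            · exact absurd hwY (fun hwY' => (h (fun hwu => huB (hwu ▸ hwB))) hwY')
            · have : w ∈ B \ Y := mem_sdiff.2 ⟨hwB, hwY⟩
              rw [hb, mem_singleton] at this
              exact this
          · intro hwb
            rw [hwb]
            exact ⟨(mem_sdiff.1 (hb ▸ mem_singleton_self b)).1, fun _ h => hbY h⟩
      have hYB2 : Y \ B = {y₂, y₁} := by rw [hYB, pair_comm]
      obtain ⟨hn1, hx1, hb1⟩ := near1 hne hYB hy₁.1 hy₂.1 hy₁B hy₂B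
      obtain ⟨hn2, hx2, hb2⟩ := near1 hne.symm hYB2 hy₂.1 hy₁.1 hy₂B hy₁B
      have hy₁b : y₁ ≠ b := fun h => hbY (by rw [← h]; exact hy₁.1)
      have hy₂b : y₂ ≠ b := fun h => hbY (by rw [← h]; exact hy₂.1)
      rw [reroute_near D hn1 hx1 hb1, reroute_near D hn2 hx2 hb2, if_neg hy₁b, if_neg hy₂b]
      ring
  · intro z hz hzD
    unfold reroutep
    apply sum_eq_zero
    intro y _
    apply reroute_of_not_near
    intro hn
    exact not_mem_code_of_near hD hB hn hzD

/-! ### The corrected weights: exact rows and columns -/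

/-- **The row sums of the corrected weights are `1`** at every `X ∈ P` (`j < n`). -/
theorem sum_sups_totalWp {j : ℕ} {D : Finset (Finset α)} (hD : IsCode j D) (hjn : j < Fintype.card α)
    {X : Finset α} (hX : X ∈ punctured j D) : ∑ Y ∈ sups j X, totalWp α j D X Y = 1 := by
  have hXc := (mem_punctured.1 hX).1
  have h1 : ∀ Y ∈ sups j X, totalWp α j D X Y = superWp α j D X Y + ∑ B ∈ D, reroutep α j D B X Y := by
    intro Y hY
    obtain ⟨hYc, hXY⟩ := mem_sups.1 hY
    obtain ⟨z, hz⟩ := card_eq_one.1 (card_sdiff_eq_one hXc hYc hXY)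
    unfold totalWp superWp reroutep totalW
    rw [hz, sum_singleton, sum_singleton]
    simp only [sum_singleton]
  rw [sum_congr rfl h1, sum_add_distrib, sum_sups_superWp hD hjn hX, sum_comm]
  have h2 : ∀ B ∈ D, ∑ Y ∈ sups j X, reroutep α j D B X Y = 0 := by
    intro B hB
    rw [sum_sups hXc]
    have h3 : ∀ y ∈ univ \ X, reroutep α j D B X (insert y X) = reroute α j D B X y :=
      fun y hy => reroutep_insert j D B X (mem_sdiff.1 hy).2
    rw [sum_congr rfl h3]
    exact sum_reroute_row hD hjn hB hXc
  rw [sum_eq_zero h2, add_zero]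

/-- **The column sums of the corrected weights are exactly `#P/#Y`** at every `(j+1)`-set (`0 < j < n`). -/
theorem sum_subsP_totalWp {j : ℕ} {D : Finset (Finset α)} (hD : IsCode j D) (hj : 0 < j)
    (hjn : j < Fintype.card α) {Y : Finset α} (hY : Y.card = j + 1) :
    ∑ X ∈ subsP j D Y, totalWp α j D X Y = ((punctured j D).card : ℚ) / (levelAbove α j).card := by
  rw [ratio_code hD hjn]
  have h1 : ∀ X ∈ subsP j D Y, totalWp α j D X Y = superWp α j D X Y + ∑ B ∈ D, reroutep α j D B X Y := by
    intro X hX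
    obtain ⟨⟨hXc, -⟩, hXY⟩ := mem_subsP.1 hX
    obtain ⟨z, hz⟩ := card_eq_one.1 (card_sdiff_eq_one hXc hY hXY)
    unfold totalWp superWp reroutep totalW
    rw [hz, sum_singleton, sum_singleton]
    simp only [sum_singleton]
  rw [sum_congr rfl h1, sum_add_distrib, sum_comm]
  by_cases hT : Touched D Y
  · obtain ⟨B₀, hB₀, hB₀Y⟩ := hT
    obtain ⟨y₀, hy₀, hYeq⟩ : ∃ y₀, y₀ ∉ B₀ ∧ Y = insert y₀ B₀ := by
      have h1' : (Y \ B₀).card = 1 := card_sdiff_eq_one (hD.1 B₀ hB₀) hY hB₀Y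
      obtain ⟨y₀, hy₀⟩ := card_eq_one.1 h1'
      have hmem : y₀ ∈ Y \ B₀ := hy₀ ▸ mem_singleton_self y₀
      rw [mem_sdiff] at hmem
      refine ⟨y₀, hmem.2, ?_⟩
      apply eq_of_subset_of_card_le
      · intro w hw
        by_cases hwB : w ∈ B₀
        · exact mem_insert_of_mem hwB
        · have : w ∈ Y \ B₀ := mem_sdiff.2 ⟨hw, hwB⟩
          rw [hy₀, mem_singleton] at this
          exact this ▸ mem_insert_self _ _
      · rw [card_insert_of_notMem hmem.2, hD.1 B₀ hB₀, hY]
    subst hYeq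
    rw [sum_subsP_superWp_touched hD hj hjn hB₀ hy₀]
    have h2 : ∀ B ∈ D, ∑ X ∈ subsP j D (insert y₀ B₀), reroutep α j D B X (insert y₀ B₀) =
        if B = B₀ then - errE α j D B₀ y₀ else 0 := by
      intro B hB
      split_ifs with hBB₀
      · subst hBB₀
        exact sum_reroute_col_touched hD hj hB hy₀
      · apply sum_reroute_col_untouched hD hB hY
        intro h
        exact hBB₀ (code_unique_of_subset hD hB hB₀ hY h (subset_insert _ _))
    rw [sum_congr rfl h2, sum_ite_eq' D B₀, if_pos hB₀]
    ring
  · rw [sum_subsP_superWp_untouched hD hj hjn hY hT]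
    have h2 : ∀ B ∈ D, ∑ X ∈ subsP j D Y, reroutep α j D B X Y = 0 := by
      intro B hB
      exact sum_reroute_col_untouched hD hB hY (fun h => hT ⟨B, hB, h⟩)
    rw [sum_eq_zero h2, add_zero]

end PercRepro.PuncturedLYM
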